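import Mathlib
import Summits.RiemannHypothesis.RiemannHypothesis.Theorems.WeilFarCoercivityFloor
import Summits.RiemannHypothesis.RiemannHypothesis.Theorems.SignConeSignConeOscillatoryExtremalNonnegMollifier
import HarnessLib

/-!
# Smoothing an admissible window function: Jensen contraction of norm, increments and prime-shift form

Helper file (`--supports stmt-RiemannHypothesis-0098`, lead-track anchor: Weil-positivity window ladder, format-C far bound),
pure proofs, RH-free.  Seat rh-explicit-weil-1 gen11 (memo `run/shared/lean/pub/rh-explicit/rh-explicit-weil-1/FORMAT-K3.md` §12.6).

The RH anatomy of the prime-shift form (`WeilFarFloorRHCeiling`) is stated for SMOOTH Weil tests; the envelope route to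
«RH ⟹ λ_max(a) ≤ e^a + O(a)» (`WeilFarFloorEnvelope`, FORMAT-K3 §12.6) needs it for merely ADMISSIBLE window functions (real,
measurable, bounded, vanishing off the window).  This file is the approximation toolkit, all elementary (Jensen's inequality for a
probability weight, Fubini, translation invariance):

* `sq_integral_weight_mul_le` (JENSEN): `(∫ ψ w)² ≤ ∫ ψ w²` for a weight `ψ ≥ 0`, `∫ψ = 1`;
* for the ψ-average `Gψ(x) = ∫ ψ(y) G(x − y) dy` of an admissible `G`: `smoothed_admissible`, `integral_smoothed_sq_le` (`∫Gψ² ≤ ∫G²`),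
  `integral_sq_smoothed_sub_smoothed_le` (INCREMENTS CONTRACT: `∫(Gψ(x+s) − Gψ(x))² ≤ ∫(G(x+s) − G(x))²`),
  `integral_sq_smoothed_sub_le` (`∫(Gψ − G)² ≤ δ` whenever `∫(G(x−y) − G(x))² ≤ δ` for `|y| ≤ ε ⊇ supp ψ`);
* (the `L²`-Lipschitz bound for `Q_a` itself is the sibling file `WeilFarFloorShiftFormLipschitz`);
* `ofReal_smoothed_eq_weilConv`, `isWeilTest_smoothed`, `tsupport_smoothed_subset`: with `ψ` = the normalised smooth bump of radius `ε`
  (tree: `SignCone.DualWitness.bumpC`), `Gψ` is a Weil test supported in `[−(b+ε), b+ε]` (tree `isWeilTest_conv_of_memLp`).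
Standard axioms only.
-/

set_option linter.dupNamespace false
set_option autoImplicit false

noncomputable section

open MeasureTheory Set Filter
open scoped Real Topology ArithmeticFunction.vonMangoldt

namespace Summit.RiemannHypothesis.RiemannHypothesis.Theorems.WeilFormatC

namespace FloorSmoothing

open Literature.NumberTheory.LFunctions

variable {b ε : ℝ} {G ψ : ℝ → ℝ} {C Cψ : ℝ}

/-! ## §1 Jensen's inequality for a probability weight -/

/-- **Jensen for a probability weight**: `(∫ ψ w)² ≤ ∫ ψ w²` for `ψ ≥ 0` with `∫ψ = 1` and bounded measurable `w`
(the weight vanishing off `[−ε, ε]`). -/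
theorem sq_integral_weight_mul_le {w : ℝ → ℝ} (hw : Measurable w) {Cw : ℝ} (hCw : ∀ y, |w y| ≤ Cw)
    (hψm : Measurable ψ) (hψ0 : ∀ y, 0 ≤ ψ y) (hψC : ∀ y, ψ y ≤ Cψ) (hψs : ∀ y, y ∉ Icc (-ε) ε → ψ y = 0)
    (hψ1 : ∫ y, ψ y = 1) :
    (∫ y, ψ y * w y) ^ 2 ≤ ∫ y, ψ y * w y ^ 2 := by
  -- integrability of `ψ·W` for bounded measurable `W`
  have hint : ∀ {W : ℝ → ℝ}, Measurable W → ∀ {CW : ℝ}, (∀ y, |W y| ≤ CW) → Integrable (fun y ↦ ψ y * W y) := by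
    intro W hW CW hCW
    have hdom : Integrable ((Icc (-ε) ε).indicator fun _ : ℝ ↦ Cψ * CW) :=
      (integrable_indicator_iff measurableSet_Icc).2 (integrableOn_const (by simp [Real.volume_Icc]))
    refine hdom.mono' (hψm.mul hW).aestronglyMeasurable (Eventually.of_forall fun y ↦ ?_)
    by_cases hy : y ∈ Icc (-ε) ε
    · rw [indicator_of_mem hy, Real.norm_eq_abs, abs_mul, abs_of_nonneg (hψ0 y)]
      exact mul_le_mul (hψC y) (hCW y) (abs_nonneg _) ((hψ0 0).trans (hψC 0))
    · rw [indicator_of_notMem hy, hψs y hy, zero_mul, norm_zero]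
  have hψi : Integrable ψ := by
    by_contra hni; rw [integral_undef hni] at hψ1; exact zero_ne_one hψ1
  have hCw0 : 0 ≤ Cw := (abs_nonneg _).trans (hCw 0)
  have iw := hint hw hCw
  have iw2 := hint (hw.pow_const 2) (CW := Cw ^ 2) fun y ↦ by
    rw [abs_pow]; exact pow_le_pow_left₀ (abs_nonneg _) (hCw y) 2
  set m := ∫ y, ψ y * w y with hm
  -- `0 ≤ ∫ ψ (w − m)² = ∫ψw² − 2m∫ψw + m²∫ψ = ∫ψw² − m²`
  have hpt : (fun y ↦ ψ y * (w y - m) ^ 2) = fun y ↦ ψ y * w y ^ 2 - 2 * m * (ψ y * w y) + m ^ 2 * ψ y := by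
    funext y; ring
  have h0 : 0 ≤ ∫ y, ψ y * (w y - m) ^ 2 := integral_nonneg fun y ↦ mul_nonneg (hψ0 y) (sq_nonneg _)
  have i12 : Integrable (fun y ↦ ψ y * w y ^ 2 - 2 * m * (ψ y * w y)) := iw2.sub (iw.const_mul _)
  have i3 : Integrable (fun y ↦ m ^ 2 * ψ y) := hψi.const_mul _
  rw [hpt, integral_add i12 i3, integral_sub iw2 (iw.const_mul _),
    integral_const_mul, integral_const_mul, hψ1, ← hm] at h0
  nlinarith

/-! ## §2 The ψ-average of an admissible function -/

/-- Integrability of `y ↦ ψ(y) G(x − y)·H(x' − y)`-type weighted products (bounded, weight vanishing off `[−ε, ε]`). -/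
theorem integrable_weight_mul (hψm : Measurable ψ) (hψ0 : ∀ y, 0 ≤ ψ y) (hψC : ∀ y, ψ y ≤ Cψ)
    (hψs : ∀ y, y ∉ Icc (-ε) ε → ψ y = 0) {W : ℝ → ℝ} (hW : Measurable W) {CW : ℝ} (hCW : ∀ y, |W y| ≤ CW) :
    Integrable (fun y ↦ ψ y * W y) := by
  have hdom : Integrable ((Icc (-ε) ε).indicator fun _ : ℝ ↦ Cψ * CW) :=
    (integrable_indicator_iff measurableSet_Icc).2 (integrableOn_const (by simp [Real.volume_Icc]))
  refine hdom.mono' (hψm.mul hW).aestronglyMeasurable (Eventually.of_forall fun y ↦ ?_)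
  by_cases hy : y ∈ Icc (-ε) ε
  · rw [indicator_of_mem hy, Real.norm_eq_abs, abs_mul, abs_of_nonneg (hψ0 y)]
    exact mul_le_mul (hψC y) (hCW y) (abs_nonneg _) ((hψ0 0).trans (hψC 0))
  · rw [indicator_of_notMem hy, hψs y hy, zero_mul, norm_zero]

/-- **The ψ-average is admissible**: measurable, bounded by the bound of `G`, vanishing off `[−(b+ε), b+ε]`. -/
theorem smoothed_admissible (hG : Measurable G) (hC : ∀ x, |G x| ≤ C) (hsupp : ∀ x, x ∉ Icc (-b) b → G x = 0)
    (hψm : Measurable ψ) (hψ0 : ∀ y, 0 ≤ ψ y) (hψs : ∀ y, y ∉ Icc (-ε) ε → ψ y = 0)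
    (hψ1 : ∫ y, ψ y = 1) :
    Measurable (fun x ↦ ∫ y, ψ y * G (x - y)) ∧ (∀ x, |∫ y, ψ y * G (x - y)| ≤ C) ∧
      (∀ x, x ∉ Icc (-(b + ε)) (b + ε) → ∫ y, ψ y * G (x - y) = 0) := by
  have hψi : Integrable ψ := by
    by_contra hni; rw [integral_undef hni] at hψ1; exact zero_ne_one hψ1
  refine ⟨?_, fun x ↦ ?_, fun x hx ↦ ?_⟩
  · have hF : Measurable (fun p : ℝ × ℝ ↦ ψ p.2 * G (p.1 - p.2)) :=
      (hψm.comp measurable_snd).mul (hG.comp (measurable_fst.sub measurable_snd))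
    exact (MeasureTheory.StronglyMeasurable.integral_prod_right'
      (f := fun p : ℝ × ℝ ↦ ψ p.2 * G (p.1 - p.2)) hF.stronglyMeasurable).measurable
  · calc |∫ y, ψ y * G (x - y)| ≤ ∫ y, |ψ y * G (x - y)| := abs_integral_le_integral_abs
      _ ≤ ∫ y, ψ y * C := by
          refine integral_mono_of_nonneg (Eventually.of_forall fun y ↦ abs_nonneg _) (hψi.mul_const C)
            (Eventually.of_forall fun y ↦ ?_)
          show |ψ y * G (x - y)| ≤ ψ y * C
          rw [abs_mul, abs_of_nonneg (hψ0 y)]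
          exact mul_le_mul_of_nonneg_left (hC _) (hψ0 y)
      _ = C := by rw [integral_mul_const, hψ1, one_mul]
  · refine integral_eq_zero_of_ae (Eventually.of_forall fun y ↦ ?_)
    by_cases hy : y ∈ Icc (-ε) ε
    · have hxy : x - y ∉ Icc (-b) b := fun hm ↦ hx ⟨by linarith [hm.1, hy.1], by linarith [hm.2, hy.2]⟩
      simp [hsupp _ hxy]
    · simp [hψs y hy]

/-- Product integrability of `(x, y) ↦ ψ(y)·U(x, y)` for a bounded measurable `U` vanishing unless `x ∈ [−R, R]`. -/
theorem integrable_weight_prod {U : ℝ × ℝ → ℝ} (hU : Measurable U) {CU R : ℝ} (hCU : ∀ p, |U p| ≤ CU)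
    (hUs : ∀ p : ℝ × ℝ, p.1 ∉ Icc (-R) R → p.2 ∈ Icc (-ε) ε → U p = 0)
    (hψm : Measurable ψ) (hψ0 : ∀ y, 0 ≤ ψ y) (hψC : ∀ y, ψ y ≤ Cψ) (hψs : ∀ y, y ∉ Icc (-ε) ε → ψ y = 0) :
    Integrable (fun p : ℝ × ℝ ↦ ψ p.2 * U p) (volume.prod volume) := by
  have hCU0 : 0 ≤ CU := (abs_nonneg _).trans (hCU (0, 0))
  set B : Set (ℝ × ℝ) := Icc (-R) R ×ˢ Icc (-ε) ε with hB
  have hBm : MeasurableSet B := measurableSet_Icc.prod measurableSet_Icc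
  have hBfin : (volume.prod volume) B < ⊤ := by
    rw [hB, Measure.prod_prod, Real.volume_Icc, Real.volume_Icc]
    exact ENNReal.mul_lt_top ENNReal.ofReal_lt_top ENNReal.ofReal_lt_top
  have hint : Integrable (B.indicator fun _ : ℝ × ℝ ↦ Cψ * CU) (volume.prod volume) :=
    (integrable_indicator_iff hBm).2 (integrableOn_const hBfin.ne)
  have hnn : 0 ≤ Cψ * CU := mul_nonneg ((hψ0 0).trans (hψC 0)) hCU0
  have hind0 : ∀ p : ℝ × ℝ, 0 ≤ B.indicator (fun _ : ℝ × ℝ ↦ Cψ * CU) p := fun p ↦ by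
    by_cases hp : p ∈ B
    · rw [indicator_of_mem hp]; exact hnn
    · rw [indicator_of_notMem hp]
  refine hint.mono' ((hψm.comp measurable_snd).mul hU).aestronglyMeasurable (Eventually.of_forall fun p ↦ ?_)
  by_cases hy : p.2 ∈ Icc (-ε) ε
  · by_cases hx : p.1 ∈ Icc (-R) R
    · have hp : p ∈ B := ⟨hx, hy⟩
      rw [indicator_of_mem hp, Real.norm_eq_abs, abs_mul, abs_of_nonneg (hψ0 _)]
      exact mul_le_mul (hψC _) (hCU _) (abs_nonneg _) ((hψ0 0).trans (hψC 0))
    · rw [hUs p hx hy, mul_zero, norm_zero]; exact hind0 p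
  · rw [hψs _ hy, zero_mul, norm_zero]; exact hind0 p

/-- **Jensen, integrated**: `∫ (∫ ψ(y) w(x, y) dy)² dx ≤ ∫∫ ψ(y) w(x, y)² dy dx = ∫ ψ(y) (∫ w(x,y)² dx) dy` for a bounded measurable
`w` vanishing unless `x ∈ [−R, R]`; used three times below. -/
theorem integral_sq_integral_weight_mul_le {w : ℝ × ℝ → ℝ} (hw : Measurable w) {Cw R : ℝ} (hCw : ∀ p, |w p| ≤ Cw)
    (hws : ∀ p : ℝ × ℝ, p.1 ∉ Icc (-R) R → p.2 ∈ Icc (-ε) ε → w p = 0)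
    (hψm : Measurable ψ) (hψ0 : ∀ y, 0 ≤ ψ y) (hψC : ∀ y, ψ y ≤ Cψ) (hψs : ∀ y, y ∉ Icc (-ε) ε → ψ y = 0)
    (hψ1 : ∫ y, ψ y = 1) :
    ∫ x, (∫ y, ψ y * w (x, y)) ^ 2 ≤ ∫ y, ψ y * ∫ x, w (x, y) ^ 2 := by
  have hCw0 : 0 ≤ Cw := (abs_nonneg _).trans (hCw (0, 0))
  -- product integrability of `ψ(y) w(x,y)²`
  have hF : Integrable (fun p : ℝ × ℝ ↦ ψ p.2 * w p ^ 2) (volume.prod volume) :=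
    integrable_weight_prod (hw.pow_const 2) (CU := Cw ^ 2) (R := R)
      (fun p ↦ by rw [abs_pow]; exact pow_le_pow_left₀ (abs_nonneg _) (hCw p) 2)
      (fun p hx hy ↦ by rw [hws p hx hy]; ring) hψm hψ0 hψC hψs
  have hswap : ∫ y, ψ y * ∫ x, w (x, y) ^ 2 = ∫ x, ∫ y, ψ y * w (x, y) ^ 2 := by
    rw [integral_integral_swap hF]
    refine integral_congr_ae (Eventually.of_forall fun y ↦ ?_)
    simp only
    rw [← integral_const_mul]
  rw [hswap]
  refine integral_mono_of_nonneg (Eventually.of_forall fun x ↦ sq_nonneg _) hF.integral_prod_left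
    (Eventually.of_forall fun x ↦ ?_)
  exact sq_integral_weight_mul_le (w := fun y ↦ w (x, y)) (hw.comp (measurable_const.prodMk measurable_id))
    (fun y ↦ hCw _) hψm hψ0 hψC hψs hψ1

/-- **Norm contraction**: `∫ (∫ψ(y)G(x−y)dy)² dx ≤ ∫ G²`. -/
theorem integral_smoothed_sq_le (hG : Measurable G) (hC : ∀ x, |G x| ≤ C) (hsupp : ∀ x, x ∉ Icc (-b) b → G x = 0)
    (hψm : Measurable ψ) (hψ0 : ∀ y, 0 ≤ ψ y) (hψC : ∀ y, ψ y ≤ Cψ) (hψs : ∀ y, y ∉ Icc (-ε) ε → ψ y = 0)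
    (hψ1 : ∫ y, ψ y = 1) :
    ∫ x, (∫ y, ψ y * G (x - y)) ^ 2 ≤ ∫ x, G x ^ 2 := by
  have h := integral_sq_integral_weight_mul_le (w := fun p : ℝ × ℝ ↦ G (p.1 - p.2))
    (hG.comp (measurable_fst.sub measurable_snd)) (Cw := C) (R := b + ε) (fun p ↦ hC _)
    (fun p hx hy ↦ hsupp _ fun hm ↦ hx ⟨by linarith [hm.1, hy.1], by linarith [hm.2, hy.2]⟩) hψm hψ0 hψC hψs hψ1
  refine h.trans (le_of_eq ?_)
  have h2 : ∀ y, ∫ x, G (x - y) ^ 2 = ∫ x, G x ^ 2 := fun y ↦ integral_sub_right_eq_self (μ := volume) (fun x ↦ G x ^ 2) y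
  simp_rw [h2]
  rw [integral_mul_const, hψ1, one_mul]

/-- **Increment contraction**: `∫ (Gψ(x + s) − Gψ(x))² dx ≤ ∫ (G(x + s) − G(x))² dx` for the ψ-average `Gψ`. -/
theorem integral_sq_smoothed_sub_smoothed_le (hG : Measurable G) (hC : ∀ x, |G x| ≤ C)
    (hsupp : ∀ x, x ∉ Icc (-b) b → G x = 0)
    (hψm : Measurable ψ) (hψ0 : ∀ y, 0 ≤ ψ y) (hψC : ∀ y, ψ y ≤ Cψ) (hψs : ∀ y, y ∉ Icc (-ε) ε → ψ y = 0)
    (hψ1 : ∫ y, ψ y = 1) (s : ℝ) :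
    ∫ x, ((∫ y, ψ y * G (x + s - y)) - ∫ y, ψ y * G (x - y)) ^ 2 ≤ ∫ x, (G (x + s) - G x) ^ 2 := by
  have hC0 : 0 ≤ C := (abs_nonneg _).trans (hC 0)
  -- `Gψ(x+s) − Gψ(x) = ∫ ψ(y)(G(x+s−y) − G(x−y)) dy`
  have hlin : ∀ x, (∫ y, ψ y * G (x + s - y)) - ∫ y, ψ y * G (x - y) = ∫ y, ψ y * (G (x + s - y) - G (x - y)) := by
    intro x
    have i1 : Integrable (fun y ↦ ψ y * G (x + s - y)) :=
      integrable_weight_mul hψm hψ0 hψC hψs (W := fun y ↦ G (x + s - y)) (hG.comp (measurable_const.sub measurable_id))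
        fun y ↦ hC _
    have i2 : Integrable (fun y ↦ ψ y * G (x - y)) :=
      integrable_weight_mul hψm hψ0 hψC hψs (W := fun y ↦ G (x - y)) (hG.comp (measurable_const.sub measurable_id))
        fun y ↦ hC _
    rw [← integral_sub i1 i2]
    refine integral_congr_ae (Eventually.of_forall fun y ↦ ?_); simp only; ring
  simp_rw [hlin]
  have h := integral_sq_integral_weight_mul_le (w := fun p : ℝ × ℝ ↦ G (p.1 + s - p.2) - G (p.1 - p.2))
    ((hG.comp ((measurable_fst.add_const s).sub measurable_snd)).sub (hG.comp (measurable_fst.sub measurable_snd)))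
    (Cw := C + C) (R := b + ε + |s|)
    (fun p ↦ (abs_sub _ _).trans (add_le_add (hC _) (hC _)))
    (fun p hx hy ↦ by
      have has := abs_nonneg s
      have h1 : p.1 - p.2 ∉ Icc (-b) b := fun hm ↦ hx ⟨by linarith [hm.1, hy.1], by linarith [hm.2, hy.2]⟩
      have h2 : p.1 + s - p.2 ∉ Icc (-b) b := fun hm ↦
        hx ⟨by linarith [hm.1, hy.1, le_abs_self s], by linarith [hm.2, hy.2, neg_abs_le s]⟩
      simp only [hsupp _ h1, hsupp _ h2, sub_zero])
    hψm hψ0 hψC hψs hψ1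
  refine h.trans (le_of_eq ?_)
  have h2 : ∀ y, ∫ x, (G (x + s - y) - G (x - y)) ^ 2 = ∫ x, (G (x + s) - G x) ^ 2 := by
    intro y
    have := integral_sub_right_eq_self (μ := volume) (fun x ↦ (G (x + s) - G x) ^ 2) y
    rw [← this]
    refine integral_congr_ae (Eventually.of_forall fun x ↦ ?_); simp only; ring_nf
  simp_rw [h2]
  rw [integral_mul_const, hψ1, one_mul]

/-- **`L²`-distance to the average**: if `∫ (G(x − y) − G(x))² dx ≤ δ` for all `|y| ≤ ε`, then `∫ (Gψ − G)² ≤ δ`. -/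
theorem integral_sq_smoothed_sub_le (hG : Measurable G) (hC : ∀ x, |G x| ≤ C) (hsupp : ∀ x, x ∉ Icc (-b) b → G x = 0)
    (hψm : Measurable ψ) (hψ0 : ∀ y, 0 ≤ ψ y) (hψC : ∀ y, ψ y ≤ Cψ) (hψs : ∀ y, y ∉ Icc (-ε) ε → ψ y = 0)
    (hψ1 : ∫ y, ψ y = 1) {δ : ℝ} (hδ : ∀ y ∈ Icc (-ε) ε, ∫ x, (G (x - y) - G x) ^ 2 ≤ δ) :
    ∫ x, ((∫ y, ψ y * G (x - y)) - G x) ^ 2 ≤ δ := by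
  have hψi : Integrable ψ := by
    by_contra hni; rw [integral_undef hni] at hψ1; exact zero_ne_one hψ1
  have hlin : ∀ x, (∫ y, ψ y * G (x - y)) - G x = ∫ y, ψ y * (G (x - y) - G x) := by
    intro x
    have i1 : Integrable (fun y ↦ ψ y * G (x - y)) :=
      integrable_weight_mul hψm hψ0 hψC hψs (W := fun y ↦ G (x - y)) (hG.comp (measurable_const.sub measurable_id))
        fun y ↦ hC _
    have i2 : Integrable (fun y ↦ ψ y * G x) := hψi.mul_const _
    have e : (fun y ↦ ψ y * (G (x - y) - G x)) = fun y ↦ ψ y * G (x - y) - ψ y * G x := funext fun y ↦ by ring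
    rw [e, integral_sub i1 i2, integral_mul_const, hψ1, one_mul]
  simp_rw [hlin]
  have h := integral_sq_integral_weight_mul_le (w := fun p : ℝ × ℝ ↦ G (p.1 - p.2) - G p.1)
    ((hG.comp (measurable_fst.sub measurable_snd)).sub (hG.comp measurable_fst))
    (Cw := C + C) (R := b + ε)
    (fun p ↦ (abs_sub _ _).trans (add_le_add (hC _) (hC _)))
    (fun p hx hy ↦ by
      have h1 : p.1 - p.2 ∉ Icc (-b) b := fun hm ↦ hx ⟨by linarith [hm.1, hy.1], by linarith [hm.2, hy.2]⟩
      have h2 : p.1 ∉ Icc (-b) b := fun hm ↦ hx ⟨by linarith [hm.1, hy.1, hy.2], by linarith [hm.2, hy.1, hy.2]⟩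
      simp only [hsupp _ h1, hsupp _ h2, sub_zero])
    hψm hψ0 hψC hψs hψ1
  refine h.trans ?_
  -- `∫ ψ(y) D(y) dy ≤ ∫ ψ(y) δ dy = δ` (the weight vanishes where the bound is not assumed)
  have hD : ∀ y, ψ y * ∫ x, (G (x - y) - G x) ^ 2 ≤ ψ y * δ := by
    intro y
    by_cases hy : y ∈ Icc (-ε) ε
    · exact mul_le_mul_of_nonneg_left (hδ y hy) (hψ0 y)
    · rw [hψs y hy, zero_mul, zero_mul]
  have hDm : ∀ y, 0 ≤ ψ y * ∫ x, (G (x - y) - G x) ^ 2 := fun y ↦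
    mul_nonneg (hψ0 y) (integral_nonneg fun x ↦ sq_nonneg _)
  calc ∫ y, ψ y * ∫ x, (G (x - y) - G x) ^ 2 ≤ ∫ y, ψ y * δ :=
        integral_mono_of_nonneg (Eventually.of_forall hDm) (hψi.mul_const δ) (Eventually.of_forall hD)
    _ = δ := by rw [integral_mul_const, hψ1, one_mul]

/-! ## §3 The smooth bump as weight: the average is a Weil test on the widened window -/

/-- Shifted products `f(x − s)·g(x − t)` of bounded measurable functions, the second vanishing off `[−a, a]`, are integrable. -/
theorem integrable_shift_mul_shift_two {a : ℝ} {f g : ℝ → ℝ} {Cf Cg : ℝ} (hf : Measurable f) (hg : Measurable g)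
    (hCf : ∀ x, |f x| ≤ Cf) (hCg : ∀ x, |g x| ≤ Cg) (hgs : ∀ x, x ∉ Icc (-a) a → g x = 0) (s t : ℝ) :
    Integrable (fun x ↦ f (x - s) * g (x - t)) := by
  have hCf0 : 0 ≤ Cf := (abs_nonneg _).trans (hCf 0)
  have hdom : Integrable ((Icc (-a + t) (a + t)).indicator fun _ : ℝ ↦ Cf * Cg) :=
    (integrable_indicator_iff measurableSet_Icc).2 (integrableOn_const (by simp [Real.volume_Icc]))
  refine hdom.mono' ((hf.comp (measurable_id.sub_const s)).mul (hg.comp (measurable_id.sub_const t))).aestronglyMeasurable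
    (Eventually.of_forall fun x ↦ ?_)
  by_cases hx : x ∈ Icc (-a + t) (a + t)
  · rw [indicator_of_mem hx, Real.norm_eq_abs, abs_mul]
    exact mul_le_mul (hCf _) (hCg _) (abs_nonneg _) hCf0
  · have hxt : x - t ∉ Icc (-a) a := fun h ↦ hx ⟨by linarith [h.1], by linarith [h.2]⟩
    rw [indicator_of_notMem hx, hgs _ hxt, mul_zero, norm_zero]

/-- The real normalised bump of radius `ε` (inner radius `ε/2`); `SignCone.DualWitness.bumpC hε x = (bumpR hε x : ℂ)` by definition. -/
theorem bumpC_eq_ofReal (hε : 0 < ε) (x : ℝ) :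
    SignCone.DualWitness.bumpC hε x
      = (((⟨ε / 2, ε, by positivity, by linarith⟩ : ContDiffBump (0 : ℝ)).normed volume x : ℝ) : ℂ) := rfl

/-- The real bump is an admissible weight: measurable, nonnegative, bounded by `1/ε`, vanishing off `[−ε, ε]`, total mass `1`. -/
theorem bump_weight (hε : 0 < ε) :
    Measurable (fun y ↦ (⟨ε / 2, ε, by positivity, by linarith⟩ : ContDiffBump (0 : ℝ)).normed volume y) ∧
    (∀ y, 0 ≤ (⟨ε / 2, ε, by positivity, by linarith⟩ : ContDiffBump (0 : ℝ)).normed volume y) ∧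
    (∀ y, (⟨ε / 2, ε, by positivity, by linarith⟩ : ContDiffBump (0 : ℝ)).normed volume y ≤ 1 / ε) ∧
    (∀ y, y ∉ Icc (-ε) ε → (⟨ε / 2, ε, by positivity, by linarith⟩ : ContDiffBump (0 : ℝ)).normed volume y = 0) ∧
    ∫ y, (⟨ε / 2, ε, by positivity, by linarith⟩ : ContDiffBump (0 : ℝ)).normed volume y = 1 := by
  set φ : ContDiffBump (0 : ℝ) := ⟨ε / 2, ε, by positivity, by linarith⟩ with hφ
  refine ⟨φ.continuous_normed.measurable, fun y ↦ φ.nonneg_normed y, fun y ↦ ?_, fun y hy ↦ ?_, φ.integral_normed⟩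
  · have h := φ.normed_le_div_measure_closedBall_rIn (μ := volume) y
    have hr : φ.rIn = ε / 2 := rfl
    rw [hr, Real.volume_real_closedBall (by positivity)] at h
    calc φ.normed volume y ≤ 1 / (2 * (ε / 2)) := h
      _ = 1 / ε := by ring
  · have hy' : y ∉ Function.support (φ.normed volume) := by
      rw [φ.support_normed_eq]
      intro hmem
      have hr : φ.rOut = ε := rfl
      rw [hr, Metric.mem_ball, dist_zero_right, Real.norm_eq_abs, abs_lt] at hmem
      exact hy ⟨hmem.1.le, hmem.2.le⟩
    simpa [Function.mem_support] using hy'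

/-- The bump-average of a real `G`, cast to `ℂ`, IS the tree's `weilConv (G : ℂ) (bumpC hε)`. -/
theorem ofReal_smoothed_eq_weilConv (hε : 0 < ε) (G : ℝ → ℝ) :
    (fun x ↦ ((∫ y, (⟨ε / 2, ε, by positivity, by linarith⟩ : ContDiffBump (0 : ℝ)).normed volume y * G (x - y) : ℝ) : ℂ))
      = weilConv (fun t ↦ (G t : ℂ)) (SignCone.DualWitness.bumpC hε) := by
  funext x
  rw [weilConv_apply]
  simp only [bumpC_eq_ofReal]
  have h1 : ∫ u, (G u : ℂ) * (((⟨ε / 2, ε, by positivity, by linarith⟩ : ContDiffBump (0 : ℝ)).normed volume (x - u) : ℝ) : ℂ)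
      = ((∫ u, G u * (⟨ε / 2, ε, by positivity, by linarith⟩ : ContDiffBump (0 : ℝ)).normed volume (x - u) : ℝ) : ℂ) := by
    rw [← integral_complex_ofReal]
    refine integral_congr_ae (Eventually.of_forall fun u ↦ ?_)
    push_cast; ring
  rw [h1]
  congr 1
  have h2 := integral_sub_left_eq_self
    (fun u ↦ G u * (⟨ε / 2, ε, by positivity, by linarith⟩ : ContDiffBump (0 : ℝ)).normed volume (x - u)) volume x
  rw [← h2]
  refine integral_congr_ae (Eventually.of_forall fun y ↦ ?_)
  simp only [sub_sub_cancel]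
  ring

/-- A bounded measurable function vanishing off `[−b, b]`, cast to `ℂ`, is in `L²` with support in the window. -/
theorem memLp_two_ofReal (hG : Measurable G) (hC : ∀ x, |G x| ≤ C) (hsupp : ∀ x, x ∉ Icc (-b) b → G x = 0) :
    MemLp (fun t ↦ (G t : ℂ)) 2 volume ∧ Function.support (fun t ↦ (G t : ℂ)) ⊆ Icc (-b) b := by
  refine ⟨?_, fun t ht ↦ ?_⟩
  · have hmeas : AEStronglyMeasurable (fun t ↦ (G t : ℂ)) volume :=
      (Complex.continuous_ofReal.measurable.comp hG).aestronglyMeasurable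
    rw [memLp_two_iff_integrable_sq_norm hmeas]
    have h := integrable_shift_mul_shift_two (a := b) hG hG hC hC hsupp 0 0
    refine h.congr (Eventually.of_forall fun x ↦ ?_)
    simp only [sub_zero, Complex.norm_real, Real.norm_eq_abs, sq_abs]
    ring
  · by_contra h
    exact ht (by simp [hsupp t h])

/-- **The bump-average of an admissible window function is a Weil test** (tree: `isWeilTest_conv_of_memLp`). -/
theorem isWeilTest_smoothed (hε : 0 < ε) (hG : Measurable G) (hC : ∀ x, |G x| ≤ C)
    (hsupp : ∀ x, x ∉ Icc (-b) b → G x = 0) :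
    IsWeilTest (fun x ↦ ((∫ y, (⟨ε / 2, ε, by positivity, by linarith⟩ : ContDiffBump (0 : ℝ)).normed volume y
      * G (x - y) : ℝ) : ℂ)) := by
  rw [ofReal_smoothed_eq_weilConv hε G]
  obtain ⟨hu, hsu⟩ := memLp_two_ofReal hG hC hsupp
  exact SignCone.DualWitness.isWeilTest_conv_of_memLp hu hsu (SignCone.DualWitness.isWeilTest_bumpC hε)

/-- … and its topological support lies in the widened window `[−(b+ε), b+ε]` (tree: `tsupport_conv_bumpC_subset`). -/
theorem tsupport_smoothed_subset (hε : 0 < ε) (hG : Measurable G) (hC : ∀ x, |G x| ≤ C)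
    (hsupp : ∀ x, x ∉ Icc (-b) b → G x = 0) :
    tsupport (fun x ↦ ((∫ y, (⟨ε / 2, ε, by positivity, by linarith⟩ : ContDiffBump (0 : ℝ)).normed volume y
      * G (x - y) : ℝ) : ℂ)) ⊆ Icc (-(b + ε)) (b + ε) := by
  rw [ofReal_smoothed_eq_weilConv hε G]
  obtain ⟨-, hsu⟩ := memLp_two_ofReal hG hC hsupp
  exact SignCone.DualWitness.tsupport_conv_bumpC_subset hsu hε

end FloorSmoothing

end Summit.RiemannHypothesis.RiemannHypothesis.Theorems.WeilFormatC
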